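import Summits.Ventures.PercRepro.RankLevelSetBiIndepContainSkewPaving

/-! # RankLevelSetPavingBases — A PAVING MATROID HAS AT LEAST `C(n − 1, r − 1)` BASES; THE RELATIVE FORM ON A BASIS
(night-1 g30; dossier §42). In a paving matroid of rank `r` a dependent `r`-set `Y` has rank `r − 1` and every
`(r − 1)`-subset spans it (`closure_eq_of_dep_of_ncard`). THE INJECTION (`depMap`): fix `e`; a dependent `r`-set `Y ∌ e`
goes to itself, `Y ∋ e` to `(Y ∖ {e}) ∪ {f}` with `f ∉ cl Y` in a prescribed spanning set `G` — a base avoiding `e`; two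
dependent `r`-sets through `e` with the same image have closures containing a common `(r − 1)`-set, hence equal, but
`f₁ ∈ Y₂ ⊆ cl Y₂ = cl Y₁ ∌ f₁`. Relative form (`ncard_dep_le_of_paving`): for `X` disjoint from a spanning `G`,
`#{S ⊆ G : #S = r − #X, S ∪ X dependent} ≤ C(#G − 1, r − #X)`; hence on a basis `G = B`
(`le_ncard_good_of_paving`) `#{S ⊆ B : S ∪ X a base} ≥ C(r − 1, #X)`, and with `X = ∅`, `G = E`
(**`le_ncard_bases_of_paving`**) a paving matroid of rank `r` on `n` elements has `≥ C(n − 1, r − 1)` bases (tight: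
`U_{r−1,n−1} ⊕ coloop`; census g30: 0 violations on the 608 paving matroids ≤ 8 elements). Every declaration has a
docstring; imports: the cell's own modules and Mathlib only. Axioms: standard. -/

namespace PercRepro

open Set Matroid

variable {α : Type} (M : Matroid α) [M.Finite]

/-- ℕ-form of the paving property: a subset of `E` with fewer than `r = rank` elements is independent. -/
lemma paving_indep_of_ncard_lt (h : Paving M) {r : ℕ} (hr : M.eRank = r) {S : Set α} (hS : S ⊆ M.E)
    (hlt : S.ncard < r) : M.Indep S := by
  refine paving_indep_of_encard_lt M h hS ?_
  rw [← Set.Finite.cast_ncard_eq (M.ground_finite.subset hS), hr]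
  exact_mod_cast hlt

/-- An independent set with `r = rank` elements is a base. -/
lemma isBase_of_indep_of_ncard {r : ℕ} (hr : M.eRank = r) {S : Set α} (hS : M.Indep S) (hcard : S.ncard = r) :
    M.IsBase S := by
  refine hS.isBase_of_eRk_ge (M.ground_finite.subset hS.subset_ground) ?_
  rw [hS.eRk_eq_encard, ← Set.Finite.cast_ncard_eq (M.ground_finite.subset hS.subset_ground), hcard, hr]

/-- The rank of a set is a natural number. -/
lemma exists_eRk_eq_coe (Y : Set α) : ∃ k : ℕ, M.eRk Y = k := by
  have : M.eRk Y ≠ ⊤ := ne_top_of_le_ne_top (by rw [M.eRank_ne_top_iff]; infer_instance) (M.eRk_le_eRank Y)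
  obtain ⟨k, hk⟩ := ENat.ne_top_iff_exists.mp this
  exact ⟨k, hk.symm⟩

/-- **A dependent `r`-set has rank at most `r − 1`.** -/
lemma eRk_le_of_dep_of_ncard {r : ℕ} {Y : Set α} (hY : Y ⊆ M.E) (hYcard : Y.ncard = r) (hdep : ¬ M.Indep Y) :
    M.eRk Y ≤ ((r - 1 : ℕ) : ℕ∞) := by
  have hD : M.Dep Y := ⟨hdep, hY⟩
  have h1 := hD.eRk_lt_encard
  rw [← Set.Finite.cast_ncard_eq (M.ground_finite.subset hY), hYcard] at h1
  obtain ⟨k, hk⟩ := exists_eRk_eq_coe M Y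
  rw [hk] at h1 ⊢
  have : k < r := by exact_mod_cast h1
  exact_mod_cast (by omega : k ≤ r - 1)

/-- **In a paving matroid a dependent `r`-set is spanned by each of its `(r − 1)`-subsets**: `cl D = cl Y`. -/
lemma closure_eq_of_dep_of_ncard (h : Paving M) {r : ℕ} (hr : M.eRank = r) {Y D : Set α} (hY : Y ⊆ M.E)
    (hYcard : Y.ncard = r) (hdep : ¬ M.Indep Y) (hD : D ⊆ Y) (hDcard : D.ncard = r - 1) :
    M.closure D = M.closure Y := by
  have hr1 : 1 ≤ r := by
    by_contra hlt
    have hr0 : r = 0 := by omega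
    have hYe : Y = ∅ := (Set.ncard_eq_zero (M.ground_finite.subset hY)).mp (by rw [hYcard, hr0])
    exact hdep (hYe ▸ M.empty_indep)
  have hDind : M.Indep D := paving_indep_of_ncard_lt M h hr (hD.trans hY) (by omega)
  refine (hDind.isBasis_of_eRk_ge (M.ground_finite.subset (hD.trans hY)) hD ?_ hY).closure_eq_closure
  rw [hDind.eRk_eq_encard, ← Set.Finite.cast_ncard_eq (M.ground_finite.subset (hD.trans hY)), hDcard]
  exact eRk_le_of_dep_of_ncard M hY hYcard hdep

/-- A spanning set `G` (rank `r`) is not inside the closure of a dependent `r`-set. -/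
lemma exists_mem_notMem_closure_of_dep {r : ℕ} {G Y : Set α} (hG : M.eRk G = r)
    (hY : Y ⊆ M.E) (hYcard : Y.ncard = r) (hdep : ¬ M.Indep Y) : ∃ f ∈ G, f ∉ M.closure Y := by
  by_contra hcon
  push Not at hcon
  have hsub : G ⊆ M.closure Y := hcon
  have h1 : M.eRk G ≤ M.eRk (M.closure Y) := M.eRk_mono hsub
  rw [M.eRk_closure_eq, hG] at h1
  have h2 := h1.trans (eRk_le_of_dep_of_ncard M hY hYcard hdep)
  have hr1 : 1 ≤ r := by
    by_contra hlt
    have hr0 : r = 0 := by omega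
    have hYe : Y = ∅ := (Set.ncard_eq_zero (M.ground_finite.subset hY)).mp (by rw [hYcard, hr0])
    exact hdep (hYe ▸ M.empty_indep)
  have : r ≤ r - 1 := by exact_mod_cast h2
  omega

section Injection

omit [M.Finite] in
/-- The `r`-set `S ∪ X` built from `S ⊆ G` (`#S = r − #X`, `#X ≤ r`) has `r` elements. -/
lemma ncard_union_eq_of_disjoint {G X S : Set α} (hGX : Disjoint G X) (hS : S ⊆ G) (hSfin : S.Finite)
    (hXfin : X.Finite) : (S ∪ X).ncard = S.ncard + X.ncard :=
  Set.ncard_union_eq (hGX.mono_left hS) hSfin hXfin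

omit [M.Finite] in
/-- The chosen element `f ∈ G ∖ cl(S ∪ X)` (arbitrary when none exists). -/
noncomputable def pickOut (G X : Set α) (e : α) (S : Set α) : α := by
  classical exact if hS : (G \ M.closure (S ∪ X)).Nonempty then hS.some else e

omit [M.Finite] in
/-- The injection: `S ↦ S` if `e ∉ S`, `S ↦ (S ∖ {e}) ∪ {f}` (with `f = pickOut S`) if `e ∈ S`. -/
noncomputable def depMap (G X : Set α) (e : α) (S : Set α) : Set α := by
  classical exact if e ∈ S then insert (pickOut M G X e S) (S \ {e}) else S

/-- For a dependent `r`-set `S ∪ X` (`S ⊆ G`), the picked element lies in `G` outside the closure. -/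
lemma pickOut_spec {r : ℕ} {G X : Set α} (hG : G ⊆ M.E) (hGr : M.eRk G = r) (hX : X ⊆ M.E)
    (e : α) {S : Set α} (hS : S ⊆ G) (hcard : (S ∪ X).ncard = r) (hdep : ¬ M.Indep (S ∪ X)) :
    pickOut M G X e S ∈ G ∧ pickOut M G X e S ∉ M.closure (S ∪ X) := by
  have hne : (G \ M.closure (S ∪ X)).Nonempty := by
    obtain ⟨f, hfG, hf⟩ := exists_mem_notMem_closure_of_dep M hGr (Set.union_subset (hS.trans hG) hX) hcard hdep
    exact ⟨f, hfG, hf⟩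
  unfold pickOut
  rw [dif_pos hne]
  exact ⟨hne.some_mem.1, hne.some_mem.2⟩

omit [M.Finite] in
/-- The map on a set through `e`. -/
lemma depMap_of_mem {G X : Set α} (e : α) {S : Set α} (heS : e ∈ S) :
    depMap M G X e S = insert (pickOut M G X e S) (S \ {e}) := by
  unfold depMap
  rw [if_pos heS]

omit [M.Finite] in
/-- The map on a set avoiding `e`. -/
lemma depMap_of_notMem {G X : Set α} (e : α) {S : Set α} (heS : e ∉ S) : depMap M G X e S = S := by
  unfold depMap
  rw [if_neg heS]

/-- The image of a dependent `r`-set through `e` under the map is a base: `(S ∖ {e}) ∪ {f} ∪ X` is independent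
with `r` elements (`cl((S ∖ {e}) ∪ X) = cl(S ∪ X) ∌ f`). -/
lemma isBase_depMap_of_mem (h : Paving M) {r : ℕ} (hr : M.eRank = r) {G X : Set α} (hG : G ⊆ M.E)
    (hGr : M.eRk G = r) (hX : X ⊆ M.E) (hGX : Disjoint G X) (e : α) {S : Set α} (hS : S ⊆ G)
    (hScard : S.ncard = r - X.ncard) (hXr : X.ncard + 1 ≤ r) (hdep : ¬ M.Indep (S ∪ X)) (heS : e ∈ S) :
    M.IsBase (depMap M G X e S ∪ X) := by
  have hSfin : S.Finite := M.ground_finite.subset (hS.trans hG)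
  have hXfin : X.Finite := M.ground_finite.subset hX
  have hcard : (S ∪ X).ncard = r := by
    rw [ncard_union_eq_of_disjoint hGX hS hSfin hXfin, hScard]; omega
  obtain ⟨hfG, hf⟩ := pickOut_spec M hG hGr hX e hS hcard hdep
  set f := pickOut M G X e S with hfdef
  have hSXE : S ∪ X ⊆ M.E := Set.union_subset (hS.trans hG) hX
  have hD : (S \ {e}) ∪ X ⊆ S ∪ X := Set.union_subset_union_left X Set.sdiff_subset
  have hDcard : ((S \ {e}) ∪ X).ncard = r - 1 := by
    rw [Set.ncard_union_eq (hGX.mono_left (Set.sdiff_subset.trans hS)) (hSfin.subset Set.sdiff_subset) hXfin,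
      Set.ncard_sdiff_singleton_of_mem heS, hScard]
    omega
  have hcl := closure_eq_of_dep_of_ncard M h hr hSXE hcard hdep hD hDcard
  have hDind : M.Indep ((S \ {e}) ∪ X) := paving_indep_of_ncard_lt M h hr (hD.trans hSXE) (by omega)
  have hfD : f ∉ (S \ {e}) ∪ X := fun hmem => hf (hcl ▸ M.mem_closure_of_mem hmem (hD.trans hSXE))
  have hind : M.Indep (insert f ((S \ {e}) ∪ X)) := by
    rw [hDind.insert_indep_iff_of_notMem hfD, hcl]
    exact ⟨hG hfG, hf⟩
  have heq : depMap M G X e S ∪ X = insert f ((S \ {e}) ∪ X) := by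
    rw [depMap_of_mem M e heS, ← hfdef, Set.insert_union]
  rw [heq]
  refine isBase_of_indep_of_ncard M hr hind ?_
  rw [Set.ncard_insert_of_notMem hfD (M.ground_finite.subset (hD.trans hSXE)), hDcard]
  omega

/-- The image avoids `e` and lies in `G` with `r − #X` elements. -/
lemma depMap_mem_target {r : ℕ} {G X : Set α} (hG : G ⊆ M.E) (hGr : M.eRk G = r)
    (hX : X ⊆ M.E) (hGX : Disjoint G X) (e : α) {S : Set α} (hS : S ⊆ G) (hScard : S.ncard = r - X.ncard)
    (hXr : X.ncard + 1 ≤ r) (hdep : ¬ M.Indep (S ∪ X)) :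
    depMap M G X e S ⊆ G \ {e} ∧ (depMap M G X e S).ncard = r - X.ncard := by
  have hSfin : S.Finite := M.ground_finite.subset (hS.trans hG)
  have hXfin : X.Finite := M.ground_finite.subset hX
  by_cases heS : e ∈ S
  · rw [depMap_of_mem M e heS]
    have hcard : (S ∪ X).ncard = r := by
      rw [ncard_union_eq_of_disjoint hGX hS hSfin hXfin, hScard]; omega
    obtain ⟨hfG, hf⟩ := pickOut_spec M hG hGr hX e hS hcard hdep
    set f := pickOut M G X e S
    have hSXE : S ∪ X ⊆ M.E := Set.union_subset (hS.trans hG) hX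
    have hfS : f ∉ S := fun hmem => hf (M.mem_closure_of_mem (Set.mem_union_left X hmem) hSXE)
    have hfe : f ≠ e := fun hfe => hfS (hfe ▸ heS)
    refine ⟨?_, ?_⟩
    · intro x hx
      rcases hx with rfl | ⟨hxS, hxe⟩
      · exact ⟨hfG, fun hx => hfe (Set.mem_singleton_iff.mp hx)⟩
      · exact ⟨hS hxS, hxe⟩
    · rw [Set.ncard_insert_of_notMem (fun hmem => hfS hmem.1) (hSfin.subset Set.sdiff_subset),
        Set.ncard_sdiff_singleton_of_mem heS, hScard]
      omega
  · rw [depMap_of_notMem M e heS]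
    exact ⟨fun x hx => ⟨hS hx, fun hxe => heS (Set.mem_singleton_iff.mp hxe ▸ hx)⟩, hScard⟩

/-- **Injectivity** of the map on the dependent `r`-sets `S ∪ X`. -/
lemma depMap_injOn (h : Paving M) {r : ℕ} (hr : M.eRank = r) {G X : Set α} (hG : G ⊆ M.E) (hGr : M.eRk G = r)
    (hX : X ⊆ M.E) (hGX : Disjoint G X) (e : α) {S₁ S₂ : Set α} (hS₁ : S₁ ⊆ G) (hS₂ : S₂ ⊆ G)
    (hc₁ : S₁.ncard = r - X.ncard) (hc₂ : S₂.ncard = r - X.ncard) (hXr : X.ncard + 1 ≤ r)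
    (hd₁ : ¬ M.Indep (S₁ ∪ X)) (hd₂ : ¬ M.Indep (S₂ ∪ X)) (heq : depMap M G X e S₁ = depMap M G X e S₂) :
    S₁ = S₂ := by
  have hS₁fin : S₁.Finite := M.ground_finite.subset (hS₁.trans hG)
  have hS₂fin : S₂.Finite := M.ground_finite.subset (hS₂.trans hG)
  have hXfin : X.Finite := M.ground_finite.subset hX
  by_cases h₁ : e ∈ S₁ <;> by_cases h₂ : e ∈ S₂
  · -- both through `e`
    have hcard₁ : (S₁ ∪ X).ncard = r := by
      rw [ncard_union_eq_of_disjoint hGX hS₁ hS₁fin hXfin, hc₁]; omega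
    have hcard₂ : (S₂ ∪ X).ncard = r := by
      rw [ncard_union_eq_of_disjoint hGX hS₂ hS₂fin hXfin, hc₂]; omega
    obtain ⟨hf₁G, hf₁⟩ := pickOut_spec M hG hGr hX e hS₁ hcard₁ hd₁
    obtain ⟨hf₂G, hf₂⟩ := pickOut_spec M hG hGr hX e hS₂ hcard₂ hd₂
    set f₁ := pickOut M G X e S₁ with hf₁def
    set f₂ := pickOut M G X e S₂ with hf₂def
    have hS₁E : S₁ ∪ X ⊆ M.E := Set.union_subset (hS₁.trans hG) hX
    have hS₂E : S₂ ∪ X ⊆ M.E := Set.union_subset (hS₂.trans hG) hX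
    have hf₁S : f₁ ∉ S₁ := fun hmem => hf₁ (M.mem_closure_of_mem (Set.mem_union_left X hmem) hS₁E)
    have hf₂S : f₂ ∉ S₂ := fun hmem => hf₂ (M.mem_closure_of_mem (Set.mem_union_left X hmem) hS₂E)
    rw [depMap_of_mem M e h₁, depMap_of_mem M e h₂, ← hf₁def, ← hf₂def] at heq
    by_cases hff : f₁ = f₂
    · -- same `f`: remove it from both sides
      have hf₂S₁ : f₂ ∉ S₁ \ {e} := fun hm => hf₁S (hff ▸ hm.1)
      have hf₂S₂ : f₂ ∉ S₂ \ {e} := fun hm => hf₂S hm.1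
      rw [hff] at heq
      have h1 : S₁ \ {e} = S₂ \ {e} := by
        have := congrArg (fun T => T \ {f₂}) heq
        simpa only [Set.insert_sdiff_of_mem _ (Set.mem_singleton f₂), Set.sdiff_singleton_eq_self hf₂S₁,
          Set.sdiff_singleton_eq_self hf₂S₂] using this
      have h2 : insert e (S₁ \ {e}) = insert e (S₂ \ {e}) := by rw [h1]
      rwa [Set.insert_sdiff_singleton, Set.insert_sdiff_singleton, Set.insert_eq_of_mem h₁,
        Set.insert_eq_of_mem h₂] at h2
    · exfalso
      have hf₁S₂ : f₁ ∈ S₂ \ {e} := by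
        have : f₁ ∈ insert f₂ (S₂ \ {e}) := heq ▸ Set.mem_insert f₁ _
        rcases this with h | h
        · exact absurd h hff
        · exact h
      have hf₂S₁ : f₂ ∈ S₁ \ {e} := by
        have : f₂ ∈ insert f₁ (S₁ \ {e}) := heq.symm ▸ Set.mem_insert f₂ _
        rcases this with h | h
        · exact absurd h.symm hff
        · exact h
      have hC : (S₁ \ {e}) \ {f₂} = (S₂ \ {e}) \ {f₁} := by
        ext x
        constructor
        · rintro ⟨hx, hxf₂⟩
          have : x ∈ insert f₂ (S₂ \ {e}) := heq ▸ Set.mem_insert_of_mem f₁ hx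
          rcases this with rfl | h
          · exact absurd rfl hxf₂
          · exact ⟨h, fun hxf₁ => hf₁S (Set.mem_singleton_iff.mp hxf₁ ▸ hx.1)⟩
        · rintro ⟨hx, hxf₁⟩
          have : x ∈ insert f₁ (S₁ \ {e}) := heq.symm ▸ Set.mem_insert_of_mem f₂ hx
          rcases this with rfl | h
          · exact absurd rfl hxf₁
          · exact ⟨h, fun hxf₂ => hf₂S (Set.mem_singleton_iff.mp hxf₂ ▸ hx.1)⟩
      set D := insert e (((S₁ \ {e}) \ {f₂}) ∪ X) with hDdef
      have hD₁ : D ⊆ S₁ ∪ X := by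
        intro x hx
        rcases hx with rfl | hx
        · exact Set.mem_union_left X h₁
        · rcases hx with hx | hx
          · exact Set.mem_union_left X hx.1.1
          · exact Set.mem_union_right _ hx
      have hD₂ : D ⊆ S₂ ∪ X := by
        intro x hx
        rcases hx with rfl | hx
        · exact Set.mem_union_left X h₂
        · rcases hx with hx | hx
          · rw [hC] at hx
            exact Set.mem_union_left X hx.1.1
          · exact Set.mem_union_right _ hx
      have hDcard : D.ncard = r - 1 := by
        have hCfin : ((S₁ \ {e}) \ {f₂}).Finite := hS₁fin.subset (Set.sdiff_subset.trans Set.sdiff_subset)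
        have heC : e ∉ ((S₁ \ {e}) \ {f₂}) ∪ X := by
          rintro (hx | hx)
          · exact hx.1.2 rfl
          · exact Set.disjoint_left.mp hGX (hS₁ h₁) hx
        rw [hDdef, Set.ncard_insert_of_notMem heC (hCfin.union hXfin),
          Set.ncard_union_eq (hGX.mono_left ((Set.sdiff_subset.trans Set.sdiff_subset).trans hS₁)) hCfin hXfin,
          Set.ncard_sdiff_singleton_of_mem hf₂S₁, Set.ncard_sdiff_singleton_of_mem h₁, hc₁]
        have h2 : 2 ≤ S₁.ncard := by
          rw [← Set.ncard_pair (show e ≠ f₂ from fun hef => hf₂S₁.2 (Set.mem_singleton_iff.mpr hef.symm))]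
          exact Set.ncard_le_ncard (Set.pair_subset h₁ hf₂S₁.1) hS₁fin
        omega
      have hcl₁ := closure_eq_of_dep_of_ncard M h hr hS₁E hcard₁ hd₁ hD₁ hDcard
      have hcl₂ := closure_eq_of_dep_of_ncard M h hr hS₂E hcard₂ hd₂ hD₂ hDcard
      apply hf₁
      rw [← hcl₁, hcl₂]
      exact M.mem_closure_of_mem (Set.mem_union_left X hf₁S₂.1) hS₂E
  · exfalso
    have hbase := isBase_depMap_of_mem M h hr hG hGr hX hGX e hS₁ hc₁ hXr hd₁ h₁
    rw [heq, depMap_of_notMem M e h₂] at hbase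
    exact hd₂ hbase.indep
  · exfalso
    have hbase := isBase_depMap_of_mem M h hr hG hGr hX hGX e hS₂ hc₂ hXr hd₂ h₂
    rw [← heq, depMap_of_notMem M e h₁] at hbase
    exact hd₁ hbase.indep
  · rwa [depMap_of_notMem M e h₁, depMap_of_notMem M e h₂] at heq

/-- **THE DEPENDENT COUNT**: `#{S ⊆ G : #S = r − #X, S ∪ X dependent} ≤ C(#G − 1, r − #X)` for `e ∈ G`. -/
theorem ncard_dep_le_of_paving (h : Paving M) {r : ℕ} (hr : M.eRank = r) {G X : Set α} (hG : G ⊆ M.E)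
    (hGr : M.eRk G = r) (hX : X ⊆ M.E) (hGX : Disjoint G X) {e : α} (heG : e ∈ G) (hXr : X.ncard + 1 ≤ r) :
    {S : Set α | S ⊆ G ∧ S.ncard = r - X.ncard ∧ ¬ M.Indep (S ∪ X)}.ncard ≤
      (G.ncard - 1).choose (r - X.ncard) := by
  have hGfin : G.Finite := M.ground_finite.subset hG
  have hGe : (G \ {e}).Finite := hGfin.subset Set.sdiff_subset
  have htarget : {S : Set α | S ⊆ G \ {e} ∧ S.ncard = r - X.ncard}.ncard = (G.ncard - 1).choose (r - X.ncard) := by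
    rw [ncard_subsets_of_finite hGe, Set.ncard_sdiff_singleton_of_mem heG]
  rw [← htarget]
  refine Set.ncard_le_ncard_of_injOn (depMap M G X e) ?_ ?_ (hGe.finite_subsets.subset fun S hS => hS.1)
  · rintro S ⟨hS, hScard, hdep⟩
    exact depMap_mem_target M hG hGr hX hGX e hS hScard hXr hdep
  · rintro S₁ ⟨hS₁, hc₁, hd₁⟩ S₂ ⟨hS₂, hc₂, hd₂⟩ heq
    exact depMap_injOn M h hr hG hGr hX hGX e hS₁ hS₂ hc₁ hc₂ hXr hd₁ hd₂ heq

end Injection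

/-- The `ρ`-subsets of a finite `G` split into those with `S ∪ X` a base and the dependent ones. -/
lemma ncard_good_add_ncard_dep {r : ℕ} (hr : M.eRank = r) {G X : Set α} (hG : G ⊆ M.E) (hX : X ⊆ M.E)
    (hGX : Disjoint G X) (hXr : X.ncard ≤ r) :
    {S : Set α | S ⊆ G ∧ S.ncard = r - X.ncard ∧ M.IsBase (S ∪ X)}.ncard +
      {S : Set α | S ⊆ G ∧ S.ncard = r - X.ncard ∧ ¬ M.Indep (S ∪ X)}.ncard =
      G.ncard.choose (r - X.ncard) := by
  have hGfin : G.Finite := M.ground_finite.subset hG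
  have hXfin : X.Finite := M.ground_finite.subset hX
  rw [← ncard_subsets_of_finite hGfin (r - X.ncard)]
  have hfin : {S : Set α | S ⊆ G ∧ S.ncard = r - X.ncard}.Finite := hGfin.finite_subsets.subset fun S hS => hS.1
  have hsplit : {S : Set α | S ⊆ G ∧ S.ncard = r - X.ncard} =
      {S : Set α | S ⊆ G ∧ S.ncard = r - X.ncard ∧ M.IsBase (S ∪ X)} ∪
        {S : Set α | S ⊆ G ∧ S.ncard = r - X.ncard ∧ ¬ M.Indep (S ∪ X)} := by
    ext S
    simp only [Set.mem_setOf_eq, Set.mem_union]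
    constructor
    · rintro ⟨hS, hScard⟩
      by_cases hind : M.Indep (S ∪ X)
      · refine Or.inl ⟨hS, hScard, isBase_of_indep_of_ncard M hr hind ?_⟩
        rw [Set.ncard_union_eq (hGX.mono_left hS) (hGfin.subset hS) hXfin, hScard]
        omega
      · exact Or.inr ⟨hS, hScard, hind⟩
    · rintro (⟨hS, hScard, -⟩ | ⟨hS, hScard, -⟩) <;> exact ⟨hS, hScard⟩
  have hdisj : Disjoint {S : Set α | S ⊆ G ∧ S.ncard = r - X.ncard ∧ M.IsBase (S ∪ X)}
      {S : Set α | S ⊆ G ∧ S.ncard = r - X.ncard ∧ ¬ M.Indep (S ∪ X)} := by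
    rw [Set.disjoint_left]
    rintro S ⟨-, -, hB⟩ ⟨-, -, hdep⟩
    exact hdep hB.indep
  rw [hsplit, Set.ncard_union_eq hdisj (hfin.subset (by rw [hsplit]; exact Set.subset_union_left))
    (hfin.subset (by rw [hsplit]; exact Set.subset_union_right))]

/-- **THE GOOD COUNT ON A BASIS**: for a base `B` disjoint from `X` (`#X + 1 ≤ r`),
`#{S ⊆ B : #S = r − #X, S ∪ X a base} ≥ C(r − 1, #X)`. -/
theorem le_ncard_good_of_paving (h : Paving M) {r : ℕ} (hr : M.eRank = r) {B X : Set α} (hB : M.IsBase B)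
    (hX : X ⊆ M.E) (hBX : Disjoint B X) (hXr : X.ncard + 1 ≤ r) :
    (r - 1).choose X.ncard ≤ {S : Set α | S ⊆ B ∧ S.ncard = r - X.ncard ∧ M.IsBase (S ∪ X)}.ncard := by
  have hBE : B ⊆ M.E := hB.subset_ground
  have hBcard : B.ncard = r := by
    have := hB.encard_eq_eRank
    rw [hr, ← Set.Finite.cast_ncard_eq (M.ground_finite.subset hBE)] at this
    exact_mod_cast this
  have hBr : M.eRk B = r := by rw [hB.eRk_eq_eRank, hr]
  have hne : B.Nonempty := by
    rw [← Set.ncard_pos (M.ground_finite.subset hBE), hBcard]; omega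
  obtain ⟨e, he⟩ := hne
  have hsum := ncard_good_add_ncard_dep M hr hBE hX hBX (by omega)
  have hdep := ncard_dep_le_of_paving M h hr hBE hBr hX hBX he hXr
  rw [hBcard] at hsum hdep
  -- `C(r, ρ) = C(r − 1, ρ) + C(r − 1, ρ − 1)` and `C(r − 1, ρ − 1) = C(r − 1, #X)` for `ρ = r − #X`
  have hpascal : r.choose (r - X.ncard) = (r - 1).choose (r - X.ncard) + (r - 1).choose X.ncard := by
    obtain ⟨n, hn⟩ : ∃ n, r = n + 1 := ⟨r - 1, by omega⟩
    obtain ⟨k, hk⟩ : ∃ k, r - X.ncard = k + 1 := ⟨r - X.ncard - 1, by omega⟩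
    have hsymm : n.choose k = n.choose X.ncard := by
      rw [← Nat.choose_symm (by omega : k ≤ n)]
      congr 1
      omega
    rw [hk, hn, Nat.choose_succ_succ, Nat.add_sub_cancel, hsymm, add_comm]
  omega

/-- **A PAVING MATROID OF RANK `r` ON `n` ELEMENTS HAS AT LEAST `C(n − 1, r − 1)` BASES** (tight:
`U_{r−1,n−1} ⊕ coloop`). -/
theorem le_ncard_bases_of_paving (h : Paving M) {r : ℕ} (hr : M.eRank = r) (hr1 : 1 ≤ r) :
    (M.E.ncard - 1).choose (r - 1) ≤ {B : Set α | M.IsBase B}.ncard := by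
  have hEr : M.eRk M.E = r := by rw [M.eRk_ground, hr]
  have hne : M.E.Nonempty := by
    by_contra hcon
    rw [Set.not_nonempty_iff_eq_empty] at hcon
    have : M.eRank = 0 := by rw [← M.eRk_ground, hcon, M.eRk_empty]
    rw [hr] at this
    have : r = 0 := by exact_mod_cast this
    omega
  obtain ⟨e, he⟩ := hne
  have hsum := ncard_good_add_ncard_dep M hr (Set.Subset.refl M.E) (Set.empty_subset M.E) (Set.disjoint_empty _)
    (by simp)
  have hdep := ncard_dep_le_of_paving M h hr (Set.Subset.refl M.E) hEr (Set.empty_subset M.E) (Set.disjoint_empty _)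
    he (by simp; omega)
  simp only [Set.ncard_empty, Nat.sub_zero, Set.union_empty] at hsum hdep
  have hgood : {S : Set α | S ⊆ M.E ∧ S.ncard = r ∧ M.IsBase S} = {B : Set α | M.IsBase B} := by
    ext B
    simp only [Set.mem_setOf_eq]
    constructor
    · rintro ⟨-, -, hB⟩; exact hB
    · intro hB
      refine ⟨hB.subset_ground, ?_, hB⟩
      have := hB.encard_eq_eRank
      rw [hr, ← Set.Finite.cast_ncard_eq (M.ground_finite.subset hB.subset_ground)] at this
      exact_mod_cast this
  rw [hgood] at hsum
  have hpascal : M.E.ncard.choose r = (M.E.ncard - 1).choose r + (M.E.ncard - 1).choose (r - 1) := by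
    have hn1 : 1 ≤ M.E.ncard := (Set.ncard_pos M.ground_finite).mpr ⟨e, he⟩
    obtain ⟨N, hN⟩ : ∃ N, M.E.ncard = N + 1 := ⟨M.E.ncard - 1, by omega⟩
    obtain ⟨k, hk⟩ : ∃ k, r = k + 1 := ⟨r - 1, by omega⟩
    rw [hN, hk, Nat.choose_succ_succ, Nat.add_sub_cancel, Nat.add_sub_cancel, add_comm]
  omega

end PercRepro
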